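import Literature.Analysis.FluidPDE.TaoQuantitativeLPTimeDeriv
import Literature.Analysis.FluidPDE.TaoEnstrophyLocalisation
import HarnessLib

/-!
# Tao 2021, Prop. 3.1 (i): the vorticity bounds (3.3) and the pointwise package

Analysis/FluidPDE proof file (theorems only, no named facts), step 5c of the inline programme
for `Literature.Analysis.FluidPDE.tao_quantitative_ess` (Tao 2021, Thm. 1.2).

T. Tao, arXiv:1908.04958v2, Prop. 3.1 (i), p. 8: under (3.1) `‖u‖_{L^∞_t L³_x} ≤ A`, besides
(3.2) one has for the vorticity `ω = ∇ × u`
(3.3) `P_N ω = O(AN²)`, `∇P_N ω = O(AN³)`, `∂ₜP_N ω = O(A²N⁴)`;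
p. 10: "(3.3) then follows from an additional application of (2.1)" (the curl costs one power
of `N` on each Littlewood–Paley piece). In the tree's language (`Δ̇_j = blockFn j`, `N = 2^j`,
`curl` of `VectorCalculus.lean`, `curl v = curlCLM ∘ Dv` of `TaoEnstrophyLocalisation.lean`):

* `HasBoundedDerivs.blockFn_curl`: `Δ̇_j (curl v) = curl (Δ̇_j v)`;
  `fderiv_curl_apply_eq_curl_fderiv`: `∂_m curl v = curl ∂_m v` (symmetry of second
  derivatives); `eLpNorm_top_curl_le`: `‖curl w‖_∞ ≤ κ ∑ᵢ ‖∂ᵢ w‖_∞`, `κ = ‖curlCLM‖`;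
* `IsTaoSolutionOn.prop31_i` — **the pointwise package of Prop. 3.1 (i)** for Tao-class
  solutions with `‖u(t)‖₃ ≤ A`, `A ≥ 1`, in real numbers: for all `t ∈ [0, T]`, `x`, `j`,
  `|Δ̇_j u| ≤ C 2^j A`, `‖D Δ̇_j u‖ ≤ C 4^j A`, `|Δ̇_j ω| ≤ C 4^j A`, `‖D Δ̇_j ω‖ ≤ C 8^j A`, and the
  Lipschitz-in-time forms of `∂ₜΔ̇_j u = O(A² 8^j)`, `∂ₜΔ̇_j ω = O(A² 16^j)`:
  `|Δ̇_j u(t₂,x) − Δ̇_j u(t₁,x)| ≤ C 8^j A² (t₂ − t₁)`,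
  `|Δ̇_j ω(t₂,x) − Δ̇_j ω(t₁,x)| ≤ C 16^j A² (t₂ − t₁)` — the last one from the velocity statement
  and the derivative Bernstein inequality applied to `Δ̇_j (u(t₂) − u(t₁))` (no mixed
  space-time derivatives are needed).

## Mathlib / tree search

Tree: `curlCLM`, `curl_eq_curlCLM`, `fderiv_curl`, `norm_curl_le` (`TaoEnstrophyLocalisation`),
`exists_tao_blockFn_bounds`, `exists_eLpNorm_top_fderiv_blockFn_le` (`TaoQuantitativeLPPointwise`),
`IsTaoSolutionOn.norm_blockFn_sub_blockFn_le`, `opNorm_le_sum_norm_apply_orthonormalBasis`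
(`TaoQuantitativeLPTimeDeriv`), `HasBoundedDerivs.fderiv_blockFn(_apply)`, `blockFn_comp_clm_of_bound`
(`LittlewoodPaleySmooth`). Mathlib: `ContDiffAt.isSymmSndFDerivAt`, `fderiv_clm_apply`,
`eLpNormEssSup_le_of_ae_bound`. `lean search 'blockFn_curl|curl_blockFn|prop31'`: nothing prior.

## References

* T. Tao, *Quantitative bounds for critically bounded solutions to the Navier–Stokes equations*,
  arXiv:1908.04958v2 (Proc. Sympos. Pure Math. 104, 2021), Prop. 3.1 (i), (3.2)–(3.3) p. 8,
  proof p. 10. [Tao2021QuantitativeNS]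
* H. Bahouri, J.-Y. Chemin, R. Danchin, *Fourier Analysis and Nonlinear PDE* (2011), Lemma 2.1.
  [BahouriCheminDanchin2011]
-/

noncomputable section

open MeasureTheory Set Function Filter Topology
open scoped ENNReal NNReal ContDiff RealInnerProductSpace

namespace Literature.Analysis.FluidPDE

open FunctionSpaces

section Curl

/-- From `‖a‖ₑ ≤ K 2^e A` (`ℝ≥0∞`) to `‖a‖ ≤ K 2^e A` (`ℝ`). [folklore] -/
private theorem norm_le_of_enorm_le_coe_mul {F' : Type*} [NormedAddCommGroup F'] {a : F'}
    {K : ℝ≥0} {e : ℤ} {A : ℝ} (hA : 0 ≤ A)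
    (h : ‖a‖ₑ ≤ (K : ℝ≥0∞) * (2 : ℝ≥0∞) ^ ((e : ℤ) : ℝ) * ENNReal.ofReal A) :
    ‖a‖ ≤ K * (2 : ℝ) ^ e * A := by
  rw [← FunctionSpaces.ofReal_two_zpow, ← ENNReal.ofReal_coe_nnreal,
    ← ENNReal.ofReal_mul K.coe_nonneg, ← ENNReal.ofReal_mul (by positivity), ← ofReal_norm] at h
  exact (ENNReal.ofReal_le_ofReal_iff (by positivity)).1 h

/-- `curl` is additive: `curl (f − g) = curl f − curl g` at points of differentiability. [folklore] -/
theorem curl_sub_apply {f g : EuclideanSpace ℝ (Fin 3) → EuclideanSpace ℝ (Fin 3)}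
    {x : EuclideanSpace ℝ (Fin 3)} (hf : DifferentiableAt ℝ f x) (hg : DifferentiableAt ℝ g x) :
    curl (f - g) x = curl f x - curl g x := by
  rw [curl_eq_curlCLM, curl_eq_curlCLM, curl_eq_curlCLM, fderiv_sub hf hg, map_sub]

/-- **`∂_m (curl u) = curl (∂_m u)`** for `C²` fields (the curl is a fixed linear function of the
Jacobian, and second derivatives are symmetric, `ContDiffAt.isSymmSndFDerivAt`). [folklore] -/
theorem fderiv_curl_apply_eq_curl_fderiv
    {u : EuclideanSpace ℝ (Fin 3) → EuclideanSpace ℝ (Fin 3)} (hu : ContDiff ℝ 2 u)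
    (x m : EuclideanSpace ℝ (Fin 3)) :
    fderiv ℝ (curl u) x m = curl (fun y => fderiv ℝ u y m) x := by
  rw [fderiv_curl hu x, ContinuousLinearMap.comp_apply, curl_eq_curlCLM]
  congr 1
  have hd : DifferentiableAt ℝ (fderiv ℝ u) x :=
    ((hu.fderiv_right (m := 1) (by norm_num)).differentiable one_ne_zero).differentiableAt
  rw [fderiv_clm_apply hd (differentiableAt_const m)]
  have hsymm : IsSymmSndFDerivAt ℝ u x := hu.contDiffAt.isSymmSndFDerivAt (by simp)
  ext m'
  simp [ContinuousLinearMap.flip_apply, hsymm.eq m m']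

/-- **The blocks commute with the curl**: `Δ̇_j (curl v) = curl (Δ̇_j v)` for smooth bounded
fields (`curl = curlCLM ∘ D` and `D Δ̇_j = Δ̇_j D`). [folklore] -/
theorem _root_.Literature.Analysis.FunctionSpaces.HasBoundedDerivs.blockFn_curl
    {v : EuclideanSpace ℝ (Fin 3) → EuclideanSpace ℝ (Fin 3)} (hv : HasBoundedDerivs v) (j : ℤ) :
    blockFn j (curl v) = curl (blockFn j v) := by
  obtain ⟨M, hM⟩ := hv.exists_norm_fderiv_le
  have h1 : curl v = fun x => curlCLM (fderiv ℝ v x) := rfl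
  rw [h1, blockFn_comp_clm_of_bound j curlCLM
    (hv.contDiff.continuous_fderiv (by simp)).aestronglyMeasurable hM, ← hv.fderiv_blockFn j]
  rfl

/-- **`‖curl w‖_∞ ≤ κ ∑ᵢ ‖∂ᵢ w‖_∞`**, `κ = ‖curlCLM‖`, for smooth bounded fields
(`|curl w(x)| ≤ κ ‖Dw(x)‖ ≤ κ ∑ᵢ |∂ᵢ w(x)|`). [folklore] -/
theorem eLpNorm_top_curl_le {w : EuclideanSpace ℝ (Fin 3) → EuclideanSpace ℝ (Fin 3)}
    (hw : HasBoundedDerivs w) :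
    eLpNorm (curl w) ∞ volume ≤ ‖curlCLM‖₊ *
      ∑ i, eLpNorm (fun x => fderiv ℝ w x (stdOrthonormalBasis ℝ (EuclideanSpace ℝ (Fin 3)) i))
        ∞ volume := by
  set b := stdOrthonormalBasis ℝ (EuclideanSpace ℝ (Fin 3))
  have hpt : ∀ x, ‖curl w x‖ₑ ≤ ‖curlCLM‖₊ * ∑ i, eLpNorm (fun x => fderiv ℝ w x (b i)) ∞ volume := by
    intro x
    have h1 : ‖curl w x‖ ≤ ‖curlCLM‖ * ∑ i, ‖fderiv ℝ w x (b i)‖ :=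
      (norm_curl_le w x).trans (mul_le_mul_of_nonneg_left
        (opNorm_le_sum_norm_apply_orthonormalBasis b _) (norm_nonneg curlCLM))
    rw [← ofReal_norm]
    refine (ENNReal.ofReal_le_ofReal h1).trans ?_
    rw [ENNReal.ofReal_mul (norm_nonneg curlCLM), ENNReal.ofReal_sum_of_nonneg fun i _ => norm_nonneg _,
      ← enorm_eq_nnnorm, ofReal_norm]
    gcongr with i
    rw [ofReal_norm]
    exact FunctionSpaces.enorm_le_eLpNorm_top_of_continuous volume
      (hw.fderiv_apply (b i)).continuous x
  rw [eLpNorm_exponent_top]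
  exact eLpNormEssSup_le_of_ae_enorm_bound (Eventually.of_forall hpt)

end Curl

/-! ## The pointwise package of Prop. 3.1 (i) for Tao-class solutions -/

section DimThree

variable {T : ℝ} {u₀ : EuclideanSpace ℝ (Fin 3) → EuclideanSpace ℝ (Fin 3)}
  {u : ℝ → EuclideanSpace ℝ (Fin 3) → EuclideanSpace ℝ (Fin 3)}
  {q : ℝ → EuclideanSpace ℝ (Fin 3) → ℝ}

/-- `2^j 2^j = 2^{2j}` in `ℝ≥0∞` (real powers of integer exponents). [folklore] -/
theorem two_rpow_mul_two_rpow (j : ℤ) :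
    (2 : ℝ≥0∞) ^ (j : ℝ) * (2 : ℝ≥0∞) ^ (j : ℝ) = (2 : ℝ≥0∞) ^ (((2 * j : ℤ)) : ℝ) := by
  rw [← ENNReal.rpow_add _ _ two_ne_zero ENNReal.ofNat_ne_top]
  congr 1; push_cast; ring

/-- `2^j 2^j 2^j = 2^{3j}` in `ℝ≥0∞` (real powers of integer exponents). [folklore] -/
theorem two_rpow_mul_two_rpow_mul_two_rpow (j : ℤ) :
    (2 : ℝ≥0∞) ^ (j : ℝ) * (2 : ℝ≥0∞) ^ (j : ℝ) * (2 : ℝ≥0∞) ^ (j : ℝ) =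
      (2 : ℝ≥0∞) ^ (((3 * j : ℤ)) : ℝ) := by
  rw [← ENNReal.rpow_add _ _ two_ne_zero ENNReal.ofNat_ne_top,
    ← ENNReal.rpow_add _ _ two_ne_zero ENNReal.ofNat_ne_top]
  congr 1; push_cast; ring

/-- **Tao 2021, (3.3) at `L^∞`, first two claims.** There is an absolute `C` such that for
every Tao-class solution on `[0, T]` with `‖u(t)‖₃ ≤ A` on `[0, T]`, every `t ∈ [0, T]`, `j`, `m`:
`‖Δ̇_j ω(t)‖_∞ ≤ C 4^j A` and `‖∂_m Δ̇_j ω(t)‖_∞ ≤ C ‖m‖ 8^j A`, `ω = curl u`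
("an additional application of (2.1)" to (3.2)). [cite: Tao2021QuantitativeNS, Prop. 3.1 (i) (3.3) p. 8] -/
theorem IsTaoSolutionOn.vorticity_blockFn_bounds :
    ∃ C : ℝ≥0, ∀ ⦃T : ℝ⦄ ⦃u₀ : EuclideanSpace ℝ (Fin 3) → EuclideanSpace ℝ (Fin 3)⦄
      ⦃u : ℝ → EuclideanSpace ℝ (Fin 3) → EuclideanSpace ℝ (Fin 3)⦄
      ⦃q : ℝ → EuclideanSpace ℝ (Fin 3) → ℝ⦄, IsTaoSolutionOn T 1 u₀ u q →
      ∀ ⦃A : ℝ⦄, (∀ t ∈ Icc 0 T, eLpNorm (u t) 3 volume ≤ ENNReal.ofReal A) →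
      ∀ t ∈ Icc 0 T, ∀ (j : ℤ) (m : EuclideanSpace ℝ (Fin 3)),
        eLpNorm (blockFn j (curl (u t))) ∞ volume ≤
          C * (2 : ℝ≥0∞) ^ (((2 * j : ℤ)) : ℝ) * ENNReal.ofReal A ∧
        eLpNorm (fun x => fderiv ℝ (blockFn j (curl (u t))) x m) ∞ volume ≤
          C * ENNReal.ofReal ‖m‖ * (2 : ℝ≥0∞) ^ (((3 * j : ℤ)) : ℝ) * ENNReal.ofReal A := by
  obtain ⟨C₀, hC₀⟩ := exists_tao_blockFn_bounds
  obtain ⟨CD, hCD⟩ := exists_eLpNorm_top_fderiv_blockFn_le (E := EuclideanSpace ℝ (Fin 3))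
    (ι := Fin 3)
  set b := stdOrthonormalBasis ℝ (EuclideanSpace ℝ (Fin 3))
  set K : ℝ≥0 := 3 * ‖curlCLM‖₊ * C₀ * (1 + CD) with hK
  have hK1 : ((3 * ‖curlCLM‖₊ * C₀ : ℝ≥0) : ℝ≥0∞) ≤ K := by
    rw [hK]; push_cast
    exact le_mul_of_one_le_right (by positivity) (by simp)
  have hK2 : ((3 * ‖curlCLM‖₊ * C₀ * CD : ℝ≥0) : ℝ≥0∞) ≤ K := by
    rw [hK]; push_cast; gcongr; exact le_add_self
  refine ⟨K, fun T u₀ u q h A hA t ht j m => ?_⟩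
  have hu : IsSmoothL2Field (u t) := h.isSmoothL2Field_slice ht
  have hb : HasBoundedDerivs (u t) := hu.toHasBoundedDerivs
  have hu3 : MemLp (u t) 3 volume := h.continuousInLpOn_three.1 t ht
  have h2j : ENNReal.ofReal ((2 : ℝ) ^ j) = (2 : ℝ≥0∞) ^ (j : ℝ) := FunctionSpaces.ofReal_two_zpow j
  -- the first-order bounds `‖∂_e Δ̇_j u‖_∞ ≤ C₀ 2^j ‖e‖ 2^j A`
  have hD : ∀ e : EuclideanSpace ℝ (Fin 3), eLpNorm (fun x => fderiv ℝ (blockFn j (u t)) x e) ∞ volume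
      ≤ C₀ * ENNReal.ofReal ((2 : ℝ) ^ j * ‖e‖) * ((2 : ℝ≥0∞) ^ (j : ℝ) * ENNReal.ofReal A) :=
    fun e => (hC₀ (u t) A j e (IsC1L2Field.of_isSmoothL2Field hu) hu3 (hA t ht)).2
  constructor
  · -- `Δ̇_j ω = curl Δ̇_j u`, `‖curl ·‖_∞ ≤ κ ∑ ‖∂ᵢ ·‖_∞`
    rw [hb.blockFn_curl j]
    refine (eLpNorm_top_curl_le (hb.blockFn j)).trans ?_
    calc (‖curlCLM‖₊ : ℝ≥0∞) * ∑ i, eLpNorm (fun x => fderiv ℝ (blockFn j (u t)) x (b i)) ∞ volume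
        ≤ ‖curlCLM‖₊ * ∑ _i : Fin (Module.finrank ℝ (EuclideanSpace ℝ (Fin 3))),
            C₀ * ENNReal.ofReal ((2 : ℝ) ^ j) * ((2 : ℝ≥0∞) ^ (j : ℝ) * ENNReal.ofReal A) := by
          gcongr with i
          have := hD (b i)
          rwa [b.orthonormal.1 i, mul_one] at this
      _ = ((3 * ‖curlCLM‖₊ * C₀ : ℝ≥0) : ℝ≥0∞) * ((2 : ℝ≥0∞) ^ (j : ℝ) * (2 : ℝ≥0∞) ^ (j : ℝ)) *
            ENNReal.ofReal A := by
          rw [Finset.sum_const, Finset.card_univ, Fintype.card_fin, finrank_euclideanSpace_fin,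
            nsmul_eq_mul, h2j]
          push_cast; ring
      _ ≤ K * (2 : ℝ≥0∞) ^ (((2 * j : ℤ)) : ℝ) * ENNReal.ofReal A := by
          rw [two_rpow_mul_two_rpow]
          exact mul_le_mul_of_nonneg_right (mul_le_mul_of_nonneg_right hK1 zero_le) zero_le
  · -- `∂_m Δ̇_j ω = curl Δ̇_j ∂_m u`
    have hg : HasBoundedDerivs (blockFn j (u t)) := hb.blockFn j
    have hrep : (fun x => fderiv ℝ (blockFn j (curl (u t))) x m) =
        curl (blockFn j (fun y => fderiv ℝ (u t) y m)) := by
      rw [hb.blockFn_curl j, ← hb.fderiv_blockFn_apply j m]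
      funext x
      exact fderiv_curl_apply_eq_curl_fderiv (hg.contDiff.of_le (by norm_cast)) x m
    rw [hrep]
    have hbm : HasBoundedDerivs (blockFn j (fun y => fderiv ℝ (u t) y m)) :=
      (hb.fderiv_apply m).blockFn j
    refine (eLpNorm_top_curl_le hbm).trans ?_
    have hterm : ∀ i, eLpNorm (fun x => fderiv ℝ (blockFn j (fun y => fderiv ℝ (u t) y m)) x (b i))
        ∞ volume ≤ CD * ENNReal.ofReal ((2 : ℝ) ^ j) *
          (C₀ * ENNReal.ofReal ((2 : ℝ) ^ j * ‖m‖) * ((2 : ℝ≥0∞) ^ (j : ℝ) * ENNReal.ofReal A)) := by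
      intro i
      have h1 := hCD (b i) j _ (IsC1L2Field.of_isSmoothL2Field (hu.fderiv_apply m))
      rw [b.orthonormal.1 i, mul_one] at h1
      refine h1.trans ?_
      gcongr
      rw [← hb.fderiv_blockFn_apply j m]
      exact hD m
    calc (‖curlCLM‖₊ : ℝ≥0∞) *
          ∑ i, eLpNorm (fun x => fderiv ℝ (blockFn j (fun y => fderiv ℝ (u t) y m)) x (b i)) ∞ volume
        ≤ ‖curlCLM‖₊ * ∑ _i : Fin (Module.finrank ℝ (EuclideanSpace ℝ (Fin 3))),
            CD * ENNReal.ofReal ((2 : ℝ) ^ j) *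
            (C₀ * ENNReal.ofReal ((2 : ℝ) ^ j * ‖m‖) * ((2 : ℝ≥0∞) ^ (j : ℝ) * ENNReal.ofReal A)) := by
          gcongr with i; exact hterm i
      _ = ((3 * ‖curlCLM‖₊ * C₀ * CD : ℝ≥0) : ℝ≥0∞) * ENNReal.ofReal ‖m‖ *
            ((2 : ℝ≥0∞) ^ (j : ℝ) * (2 : ℝ≥0∞) ^ (j : ℝ) * (2 : ℝ≥0∞) ^ (j : ℝ)) * ENNReal.ofReal A := by
          rw [Finset.sum_const, Finset.card_univ, Fintype.card_fin, finrank_euclideanSpace_fin,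
            nsmul_eq_mul, ENNReal.ofReal_mul (zpow_nonneg zero_le_two _), h2j]
          push_cast; ring
      _ ≤ K * ENNReal.ofReal ‖m‖ * (2 : ℝ≥0∞) ^ (((3 * j : ℤ)) : ℝ) * ENNReal.ofReal A := by
          rw [two_rpow_mul_two_rpow_mul_two_rpow]
          exact mul_le_mul_of_nonneg_right (mul_le_mul_of_nonneg_right
            (mul_le_mul_of_nonneg_right hK2 zero_le) zero_le) zero_le

/-- **Tao 2021, Prop. 3.1 (i) — the pointwise package, in real numbers.** There is an absolute
constant `C > 0` such that for every Tao-class solution `(u, q)` on `[0, T]`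
(`IsTaoSolutionOn T 1 u₀ u q`; the solutions of `tao_quantitative_ess` are of this class,
`IsHkClassicalSolutionOn.exists_isTaoSolutionOn`) obeying (3.1) `‖u(t)‖_{L³} ≤ A` on `[0, T]`
with `A ≥ 1`, for every dyadic `j` (`N = 2^j`, `Δ̇_j = blockFn j`, `ω = curl u`):
(3.2) `|Δ̇_j u(t,x)| ≤ C N A`, `‖D Δ̇_j u(t,x)‖ ≤ C N² A`,
`|Δ̇_j u(t₂,x) − Δ̇_j u(t₁,x)| ≤ C N³ A² (t₂ − t₁)`;
(3.3) `|Δ̇_j ω(t,x)| ≤ C N² A`, `‖D Δ̇_j ω(t,x)‖ ≤ C N³ A`,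
`|Δ̇_j ω(t₂,x) − Δ̇_j ω(t₁,x)| ≤ C N⁴ A² (t₂ − t₁)`, for all `t ∈ [0,T]`, `0 ≤ t₁ ≤ t₂ ≤ T`, `x`.
[cite: Tao2021QuantitativeNS, Prop. 3.1 (i) (3.2)–(3.3) p. 8] -/
theorem IsTaoSolutionOn.prop31_i :
    ∃ C : ℝ, 0 < C ∧ ∀ ⦃T : ℝ⦄ ⦃u₀ : EuclideanSpace ℝ (Fin 3) → EuclideanSpace ℝ (Fin 3)⦄
      ⦃u : ℝ → EuclideanSpace ℝ (Fin 3) → EuclideanSpace ℝ (Fin 3)⦄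
      ⦃q : ℝ → EuclideanSpace ℝ (Fin 3) → ℝ⦄, IsTaoSolutionOn T 1 u₀ u q →
      ∀ ⦃A : ℝ⦄, 1 ≤ A → (∀ t ∈ Icc 0 T, eLpNorm (u t) 3 volume ≤ ENNReal.ofReal A) →
      ∀ j : ℤ,
        (∀ t ∈ Icc 0 T, ∀ x, ‖blockFn j (u t) x‖ ≤ C * (2 : ℝ) ^ j * A) ∧
        (∀ t ∈ Icc 0 T, ∀ x, ‖fderiv ℝ (blockFn j (u t)) x‖ ≤ C * (2 : ℝ) ^ (2 * j) * A) ∧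
        (∀ ⦃t₁ t₂ : ℝ⦄, 0 ≤ t₁ → t₁ ≤ t₂ → t₂ ≤ T → ∀ x,
          ‖blockFn j (u t₂) x - blockFn j (u t₁) x‖ ≤ C * (2 : ℝ) ^ (3 * j) * A ^ 2 * (t₂ - t₁)) ∧
        (∀ t ∈ Icc 0 T, ∀ x, ‖blockFn j (curl (u t)) x‖ ≤ C * (2 : ℝ) ^ (2 * j) * A) ∧
        (∀ t ∈ Icc 0 T, ∀ x, ‖fderiv ℝ (blockFn j (curl (u t))) x‖ ≤ C * (2 : ℝ) ^ (3 * j) * A) ∧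
        (∀ ⦃t₁ t₂ : ℝ⦄, 0 ≤ t₁ → t₁ ≤ t₂ → t₂ ≤ T → ∀ x,
          ‖blockFn j (curl (u t₂)) x - blockFn j (curl (u t₁)) x‖ ≤
            C * (2 : ℝ) ^ (4 * j) * A ^ 2 * (t₂ - t₁)) := by
  obtain ⟨C₀, hC₀⟩ := exists_tao_blockFn_bounds
  obtain ⟨CD, hCD⟩ := exists_eLpNorm_top_fderiv_blockFn_le (E := EuclideanSpace ℝ (Fin 3))
    (ι := Fin 3)
  obtain ⟨C₁, hC₁⟩ := IsTaoSolutionOn.norm_blockFn_sub_blockFn_le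
  obtain ⟨C₂, hC₂⟩ := IsTaoSolutionOn.vorticity_blockFn_bounds
  set b := stdOrthonormalBasis ℝ (EuclideanSpace ℝ (Fin 3))
  -- one real constant dominating all six
  set K : ℝ := 1 + 3 * C₀ + C₁ + 3 * C₂ + 3 * ‖curlCLM‖ * CD * C₁ with hK
  have h0 : (0 : ℝ) ≤ C₀ := C₀.coe_nonneg
  have h1' : (0 : ℝ) ≤ C₁ := C₁.coe_nonneg
  have h2' : (0 : ℝ) ≤ C₂ := C₂.coe_nonneg
  have hL : (0 : ℝ) ≤ 3 * ‖curlCLM‖ * CD * C₁ := by positivity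
  have hKpos : 0 < K := by rw [hK]; linarith
  have hC₀K : (C₀ : ℝ) ≤ K := by rw [hK]; linarith
  have h3C₀K : 3 * (C₀ : ℝ) ≤ K := by rw [hK]; linarith
  have hC₁K : (C₁ : ℝ) ≤ K := by rw [hK]; linarith
  have hC₂K : (C₂ : ℝ) ≤ K := by rw [hK]; linarith
  have h3C₂K : 3 * (C₂ : ℝ) ≤ K := by rw [hK]; linarith
  have hLK : 3 * ‖curlCLM‖ * CD * C₁ ≤ K := by rw [hK]; linarith
  refine ⟨K, hKpos, fun T u₀ u q h A hA1 hA j => ?_⟩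
  have hA0 : 0 ≤ A := zero_le_one.trans hA1
  have h2j : ENNReal.ofReal ((2 : ℝ) ^ j) = (2 : ℝ≥0∞) ^ (j : ℝ) := FunctionSpaces.ofReal_two_zpow j
  -- slice facts
  have hsl : ∀ t ∈ Icc 0 T, IsSmoothL2Field (u t) := fun t ht => h.isSmoothL2Field_slice ht
  have hD : ∀ t ∈ Icc 0 T, ∀ e : EuclideanSpace ℝ (Fin 3),
      eLpNorm (fun x => fderiv ℝ (blockFn j (u t)) x e) ∞ volume ≤
        C₀ * ENNReal.ofReal ((2 : ℝ) ^ j * ‖e‖) * ((2 : ℝ≥0∞) ^ (j : ℝ) * ENNReal.ofReal A) :=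
    fun t ht e => (hC₀ (u t) A j e (IsC1L2Field.of_isSmoothL2Field (hsl t ht))
      (h.continuousInLpOn_three.1 t ht) (hA t ht)).2
  have hωb : ∀ t ∈ Icc 0 T, HasBoundedDerivs (blockFn j (curl (u t))) := fun t ht => by
    rw [(hsl t ht).toHasBoundedDerivs.blockFn_curl j]
    exact ((hsl t ht).toHasBoundedDerivs.blockFn j).fderiv.clm_comp curlCLM
  refine ⟨fun t ht x => ?_, fun t ht x => ?_, fun t₁ t₂ ht₁ h12 ht₂ x => ?_, fun t ht x => ?_,
    fun t ht x => ?_, fun t₁ t₂ ht₁ h12 ht₂ x => ?_⟩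
  · -- (3.2a)
    have h1 := (hC₀ (u t) A j 0 (IsC1L2Field.of_isSmoothL2Field (hsl t ht))
      (h.continuousInLpOn_three.1 t ht) (hA t ht)).1
    have hpt : ‖blockFn j (u t) x‖ₑ ≤ (C₀ : ℝ≥0∞) * (2 : ℝ≥0∞) ^ ((j : ℤ) : ℝ) * ENNReal.ofReal A :=
      (FunctionSpaces.enorm_le_eLpNorm_top_of_continuous volume
        ((hsl t ht).blockFn j).continuous x).trans h1
    refine (norm_le_of_enorm_le_coe_mul hA0 hpt).trans ?_
    exact mul_le_mul_of_nonneg_right (mul_le_mul_of_nonneg_right hC₀K (zpow_nonneg zero_le_two _)) hA0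
  · -- (3.2b), operator norm
    have hg : HasBoundedDerivs (blockFn j (u t)) := (hsl t ht).toHasBoundedDerivs.blockFn j
    have hdir : ∀ i, ‖fderiv ℝ (blockFn j (u t)) x (b i)‖ ≤ C₀ * (2 : ℝ) ^ (2 * j) * A := by
      intro i
      have h1 := hD t ht (b i)
      rw [b.orthonormal.1 i, mul_one, h2j] at h1
      have hpt := (FunctionSpaces.enorm_le_eLpNorm_top_of_continuous volume
        (hg.fderiv_apply (b i)).continuous x).trans h1
      have hpt' : ‖fderiv ℝ (blockFn j (u t)) x (b i)‖ₑ ≤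
          (C₀ : ℝ≥0∞) * (2 : ℝ≥0∞) ^ (((2 * j : ℤ)) : ℝ) * ENNReal.ofReal A := by
        refine hpt.trans_eq ?_
        rw [← two_rpow_mul_two_rpow]; ring
      exact norm_le_of_enorm_le_coe_mul hA0 hpt'
    calc ‖fderiv ℝ (blockFn j (u t)) x‖ ≤ ∑ i, ‖fderiv ℝ (blockFn j (u t)) x (b i)‖ :=
          opNorm_le_sum_norm_apply_orthonormalBasis b _
      _ ≤ ∑ _i : Fin (Module.finrank ℝ (EuclideanSpace ℝ (Fin 3))), (C₀ : ℝ) * (2 : ℝ) ^ (2 * j) * A :=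
          Finset.sum_le_sum fun i _ => hdir i
      _ = 3 * (C₀ : ℝ) * (2 : ℝ) ^ (2 * j) * A := by
          rw [Finset.sum_const, Finset.card_univ, Fintype.card_fin, finrank_euclideanSpace_fin,
            nsmul_eq_mul]
          push_cast; ring
      _ ≤ K * (2 : ℝ) ^ (2 * j) * A :=
          mul_le_mul_of_nonneg_right (mul_le_mul_of_nonneg_right h3C₀K (zpow_nonneg zero_le_two _)) hA0
  · -- (3.2c), Lipschitz in time
    refine (hC₁ h hA1 hA j ht₁ h12 ht₂ x).trans ?_
    have : 0 ≤ t₂ - t₁ := sub_nonneg.2 h12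
    exact mul_le_mul_of_nonneg_right (mul_le_mul_of_nonneg_right (mul_le_mul_of_nonneg_right hC₁K
      (zpow_nonneg zero_le_two _)) (sq_nonneg A)) this
  · -- (3.3a)
    have h1 := (hC₂ h hA t ht j 0).1
    have hpt := (FunctionSpaces.enorm_le_eLpNorm_top_of_continuous volume
      (hωb t ht).continuous x).trans h1
    refine (norm_le_of_enorm_le_coe_mul hA0 hpt).trans ?_
    exact mul_le_mul_of_nonneg_right (mul_le_mul_of_nonneg_right hC₂K (zpow_nonneg zero_le_two _)) hA0
  · -- (3.3b), operator norm
    have hdir : ∀ i, ‖fderiv ℝ (blockFn j (curl (u t))) x (b i)‖ ≤ C₂ * (2 : ℝ) ^ (3 * j) * A := by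
      intro i
      have h1 := (hC₂ h hA t ht j (b i)).2
      rw [b.orthonormal.1 i, ENNReal.ofReal_one, mul_one] at h1
      exact norm_le_of_enorm_le_coe_mul hA0
        ((FunctionSpaces.enorm_le_eLpNorm_top_of_continuous volume
          ((hωb t ht).fderiv_apply (b i)).continuous x).trans h1)
    calc ‖fderiv ℝ (blockFn j (curl (u t))) x‖ ≤ ∑ i, ‖fderiv ℝ (blockFn j (curl (u t))) x (b i)‖ :=
          opNorm_le_sum_norm_apply_orthonormalBasis b _
      _ ≤ ∑ _i : Fin (Module.finrank ℝ (EuclideanSpace ℝ (Fin 3))), (C₂ : ℝ) * (2 : ℝ) ^ (3 * j) * A :=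
          Finset.sum_le_sum fun i _ => hdir i
      _ = 3 * (C₂ : ℝ) * (2 : ℝ) ^ (3 * j) * A := by
          rw [Finset.sum_const, Finset.card_univ, Fintype.card_fin, finrank_euclideanSpace_fin,
            nsmul_eq_mul]
          push_cast; ring
      _ ≤ K * (2 : ℝ) ^ (3 * j) * A :=
          mul_le_mul_of_nonneg_right (mul_le_mul_of_nonneg_right h3C₂K (zpow_nonneg zero_le_two _)) hA0
  · -- (3.3c): `Δ̇_j ω(t₂) - Δ̇_j ω(t₁) = curl Δ̇_j (u t₂ - u t₁)` and derivative Bernstein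
    haveI : Fact (1 ≤ (2 : ℝ≥0∞)) := ⟨one_le_two⟩
    have ht₁' : t₁ ∈ Icc 0 T := ⟨ht₁, h12.trans ht₂⟩
    have ht₂' : t₂ ∈ Icc 0 T := ⟨ht₁.trans h12, ht₂⟩
    have h12' : 0 ≤ t₂ - t₁ := sub_nonneg.2 h12
    have hf : IsSmoothL2Field (u t₂ - u t₁) := by
      rw [sub_eq_add_neg, ← neg_one_smul ℝ (u t₁)]
      exact (hsl t₂ ht₂').add ((hsl t₁ ht₁').const_smul (-1))
    have hfb : HasBoundedDerivs (blockFn j (u t₂ - u t₁)) := hf.toHasBoundedDerivs.blockFn j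
    have hsub : blockFn j (u t₂ - u t₁) = blockFn j (u t₂) - blockFn j (u t₁) :=
      blockFn_sub j (hsl t₂ ht₂').memLp_two (hsl t₁ ht₁').memLp_two
    -- `‖Δ̇_j (u t₂ - u t₁)‖_∞ ≤ C₁ 8^j A² (t₂ - t₁)`
    set R : ℝ := C₁ * (2 : ℝ) ^ (3 * j) * A ^ 2 * (t₂ - t₁) with hR
    have hR0 : 0 ≤ R := by positivity
    have htop : eLpNorm (blockFn j (u t₂ - u t₁)) ∞ volume ≤ ENNReal.ofReal R := by
      rw [eLpNorm_exponent_top]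
      refine eLpNormEssSup_le_of_ae_bound (Eventually.of_forall fun y => ?_)
      rw [hsub, Pi.sub_apply]
      exact hC₁ h hA1 hA j ht₁ h12 ht₂ y
    -- the identity
    have hd₂ : Differentiable ℝ (blockFn j (u t₂)) :=
      ((hsl t₂ ht₂').toHasBoundedDerivs.blockFn j).contDiff.differentiable (by simp)
    have hd₁ : Differentiable ℝ (blockFn j (u t₁)) :=
      ((hsl t₁ ht₁').toHasBoundedDerivs.blockFn j).contDiff.differentiable (by simp)
    have hid : blockFn j (curl (u t₂)) x - blockFn j (curl (u t₁)) x =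
        curl (blockFn j (u t₂ - u t₁)) x := by
      rw [(hsl t₂ ht₂').toHasBoundedDerivs.blockFn_curl j,
        (hsl t₁ ht₁').toHasBoundedDerivs.blockFn_curl j, hsub, curl_sub_apply (hd₂ x) (hd₁ x)]
    rw [hid]
    -- pointwise: `|curl g(x)| ≤ κ ∑ |∂ᵢ g(x)|`, `‖∂ᵢ Δ̇_j f‖_∞ ≤ CD 2^j ‖Δ̇_j f‖_∞`
    have hdir : ∀ i, ‖fderiv ℝ (blockFn j (u t₂ - u t₁)) x (b i)‖ ≤ CD * (2 : ℝ) ^ j * R := by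
      intro i
      have h1 := hCD (b i) j _ (IsC1L2Field.of_isSmoothL2Field hf)
      rw [b.orthonormal.1 i, mul_one] at h1
      have hpt := (FunctionSpaces.enorm_le_eLpNorm_top_of_continuous volume
        (hfb.fderiv_apply (b i)).continuous x).trans
          (h1.trans (mul_le_mul_of_nonneg_left htop zero_le))
      rw [← ENNReal.ofReal_coe_nnreal, ← ENNReal.ofReal_mul CD.coe_nonneg,
        ← ENNReal.ofReal_mul (by positivity), ← ofReal_norm] at hpt
      exact (ENNReal.ofReal_le_ofReal_iff (by positivity)).1 hpt
    calc ‖curl (blockFn j (u t₂ - u t₁)) x‖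
        ≤ ‖curlCLM‖ * ‖fderiv ℝ (blockFn j (u t₂ - u t₁)) x‖ := norm_curl_le _ x
      _ ≤ ‖curlCLM‖ * ∑ i, ‖fderiv ℝ (blockFn j (u t₂ - u t₁)) x (b i)‖ :=
          mul_le_mul_of_nonneg_left (opNorm_le_sum_norm_apply_orthonormalBasis b _)
            (norm_nonneg curlCLM)
      _ ≤ ‖curlCLM‖ * ∑ _i : Fin (Module.finrank ℝ (EuclideanSpace ℝ (Fin 3))),
            (CD : ℝ) * (2 : ℝ) ^ j * R :=
          mul_le_mul_of_nonneg_left (Finset.sum_le_sum fun i _ => hdir i) (norm_nonneg curlCLM)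
      _ = 3 * ‖curlCLM‖ * CD * C₁ * (2 : ℝ) ^ (4 * j) * A ^ 2 * (t₂ - t₁) := by
          rw [Finset.sum_const, Finset.card_univ, Fintype.card_fin, finrank_euclideanSpace_fin,
            nsmul_eq_mul, hR]
          have h4 : (2 : ℝ) ^ (4 * j) = (2 : ℝ) ^ j * (2 : ℝ) ^ (3 * j) := by
            rw [← zpow_add₀ (two_ne_zero (α := ℝ))]; ring_nf
          rw [h4]; push_cast; ring
      _ ≤ K * (2 : ℝ) ^ (4 * j) * A ^ 2 * (t₂ - t₁) :=
          mul_le_mul_of_nonneg_right (mul_le_mul_of_nonneg_right (mul_le_mul_of_nonneg_right hLK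
            (zpow_nonneg zero_le_two _)) (sq_nonneg A)) h12'

end DimThree

end Literature.Analysis.FluidPDE
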